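import Summits.HodgeConjecture.HodgeConjecture.Theorems.F0P2oLineJacquetAtBlockFrame      -- (C5) B-p10 (g23): `exists_lineJacquet_intertwiner_blockFrame` (+ ★ (BF), (LM), ★ p837961 transitively)
import Summits.HodgeConjecture.HodgeConjecture.Theorems.F0P2oLineJacquetReindex            -- (J4) ★ B-p14 (g29): `lineJacquet_reindex_std` (+ ★ p838314 (J1)(J2)(J3) transitively)
import Summits.HodgeConjecture.HodgeConjecture.Theorems.F0P2oKernelLineNormUnit            -- (KL) ★ p838305: `exists_unit_norm_kernelLineCM`
import Summits.HodgeConjecture.HodgeConjecture.Theorems.F0P2oBlockFrameIsotropyBridge      -- (IB) ★ p838392 B-p08 (g25): `exists_ne_zero_hermForm_self_eq_zero_of_isIsotropic` (+ ★ (F′) p836975)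
import HarnessLib

/-!
# Crux `H413`, programme P2, N3 road (a) — (JA) THE JUNCTION: the line-Jacquet intertwiner (N′) FOR EVERY LETTER DATUM, hypothesis-free,
# and the print letter ★ `GelbartRogawski1991.thetaType_nonsplit_jacquetModule` (#96) AS A THEOREM

Cell hodgecm-mathlib (D-0151), FLOOR 0, crux item H413 = stmt-HodgeConjecture-24833, programme P2; K1 sub-line `Cruxes/H413/Lines/F0_P2GR91NJacquetK1.lean`
(residue = the print letter N3 #96); N3 road of the K1 lead B-p18 (g29), SOCKET (B) «N3 DIRECT FOLD» (lead 2026-08-31T23:47:37Z (5), desk F0P2-plan (g9) 23:47:55Z),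
junction (JA) dealt to this seat 2026-09-01T00:02Z.  Seat F0P2-p06 (g4).  THEOREMS ONLY (no `def`, no instance, no notation, no named fact, no `sorry`); no
`Cruxes/…/Lines` import; kernel lane `--supports stmt-HodgeConjecture-24833 --as helper`.  HONEST LABEL: HC_CM is proved only modulo the 2 remaining named inputs
(hLiu418, h413) — behind them the booked printed statements + the MOD package — until rung 0 closes.  This file DISCHARGES one booked printed statement: after it,
★ `GelbartRogawski1991.thetaType_nonsplit_jacquetModule` [GelbartRogawski1991 §3.2 (3.2.1)–(3.2.3) p. 457; Kudla1986 Thm. 2.8] is a theorem of the tree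
(`thetaType_nonsplit_jacquetModule_holds`), closing the K1 sub-line's last `sorry` (`stub_N3_letter`) by one token.

THE ROUTE (lead B-p18 (g29)'s order of record, every brick ★ and cited BY NAME).  For a letter datum `(L, e₁, dV, e₀, μ, v` non-split, `ε, T, a, h)`:
(F′) ★ p836975 `RationalHyperbolicFrame.exists_rational_hyperbolic_realDiagonal_frame` — a rational frame `P ∈ GL₃(L⁺)` with `Pᵀ·diag(dV)·P = diag(dV′)`,
`dV′ = (t, a′₀, a′₁)`, the plane `diag(a′)` isotropic at `v` (`E_v` is a field: ★ `LocalRing.isField_of_smul_eq`) → (IB) ★ p838392 an isotropic vector `x` →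
★ `exists_hyperbolic_partner_of_nonsplit` (`xs`, `⟨x, xs⟩ = dV′ 0`) → (BF) ★ p837182 `exists_blockAdaptedCongr` (the block-adapted congruence `T₀` of `diag(dV′)`,
`T₀·d(1,β,1)·T₀⁻¹ = inl(β)`) → (C5) ★ B-p10 (g23) `exists_lineJacquet_intertwiner_blockFrame` ((N′) at `(e_std, dV′, T₀)` with the frame line `(dV′ 0)`: the chart
★ p835408 factorises ★ p838184, the local see-saw ★ p836839, boxes span) → §1 (C5c′) the V-line hop `(dV′ 0) ↝ kernelLineCM dV′` at the letter's `e₀` (★ (KL)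
p838305 + ★ (LM) p836568 + ★ (J1) p838314) → ★ (J3) `lineJacquet_congruenceChange_of_formCongr` (`T₀ ↝ T′ := framePloc(P)⁻¹·T`, ★ `formCongr_framePlocInv_mul`)
→ ★ (J2) `lineJacquet_frameTransport_ofRecord` (`(dV′, T′) ↝ (dV, T)`) → ★ (J4) `lineJacquet_reindex_std` (`e_std ↝ e₁`).  Then ★ p837961
`F0P2oN3OfLineJacquet.thetaType_nonsplit_jacquetModule_of_lineJacquet` gives N3.

HEADS: §1 `lineJacquet_lineChange`; §2 `lineJacquet_of_blockDiagonalFrame` (the junction at an abstract block-diagonal frame `(P, dV′, x)`); §3 **`lineJacquet_holds`**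
(= the `hL` binder of ★ p837961, token for token) and **`thetaType_nonsplit_jacquetModule_holds : GelbartRogawski1991.thetaType_nonsplit_jacquetModule`**.

## References
* [GelbartRogawski1991] S. Gelbart, J. Rogawski, *L-functions and Fourier–Jacobi coefficients for the unitary group U(3)*, Invent. Math. 105 (1991): §3.2
  (3.2.1)–(3.2.3) p. 457; §5.2 p. 467.
* [Kudla1986] S. Kudla, *On the local theta-correspondence*, Invent. Math. 83 (1986): Thm. 2.8.
* [MoeglinVignerasWaldspurger1987] LNM 1291 (1987): Chap. 2 II Remarque (3); Chap. 3 §IV.4–5.  [Jacobowitz1962] Amer. J. Math. 84 (1962): Thm. 3.1.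
* [Rogawski1990] Ann. of Math. Stud. 123 (1990): §1.10 p. 9; §12.2 (2) p. 174.
-/

set_option autoImplicit false
-- the mandated namespace has the single-problem summit's repeated segment (`HodgeConjecture.HodgeConjecture`)
set_option linter.dupNamespace false

noncomputable section

open NumberField IsDedekindDomain MeasureTheory
open scoped Matrix Kronecker

open Literature.NumberTheory Literature.NumberTheory.Automorphic Literature.NumberTheory.Automorphic.UnitaryGroup
open Literature.NumberTheory.Automorphic.IdeleClassGroup
open Literature.NumberTheory.Automorphic.Liu2021 Literature.NumberTheory.Automorphic.Liu2021.Def411WeilCarriers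
open Literature.NumberTheory.Automorphic.Liu2021.Def411WeilCarriersDoubling
open Literature.NumberTheory.GelbartRogawski1991.UnitaryDualPair Literature.NumberTheory.GelbartRogawski1991.UnitaryDualPair.WeilCoinv
open Literature.NumberTheory.GelbartRogawski1991.UnitaryDualPair.LocalSplitting Literature.NumberTheory.GelbartRogawski1991.GRConstruction
open Literature.RepresentationTheory.Liu2021
open Literature.NumberTheory.GaloisRepresentations
open Literature.NumberTheory.Rogawski1990
open Literature.NumberTheory.GelbartRogawski1991
open Literature.RepresentationTheory Literature.RepresentationTheory.MoeglinVignerasWaldspurger1987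

open Summit.HodgeConjecture.HodgeConjecture.Cruxes.H413.F0P2oLineJacquetFrameTransport

namespace Summit.HodgeConjecture.HodgeConjecture.Cruxes.H413.F0P2oLineJacquetHolds

/-! ## §1 (C5c′) The V-line change on the line side: frame line `(dV′ 0)` at `pU₁` ↦ the Witt kernel line `kernelLineCM dV′` at the letter's `e₀` -/

section LineChange

variable (L : Type) [Field L] [NumberField L] [IsCMField L]

set_option synthInstance.maxHeartbeats 400000 in
set_option maxHeartbeats 16000000 in
/-- **(C5c′) LINE CHANGE ON THE LINE SIDE.**  If the pulled-back Weil representation `Ω_{dV′, T, e₁}` admits a line-Jacquet intertwiner onto the rank-one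
oscillator representation of the FRAME line `⟨dV′ 0⟩` read at the trivial enumeration `pU₁ = Equiv.prodUnique (Fin 1) (Fin 1)` (the shape (C5) delivers at the
block frame), then it admits one onto `ω¹` at the Witt KERNEL line `kernelLineCM dV′ = ⟨−dV′₀dV′₁dV′₂⟩` read at any `e₀` (the shape of ★ p837961's `hL`):
the two lines differ by the local norm `N(y)` of ★ (KL) `exists_unit_norm_kernelLineCM` (isotropy of the plane `diag(dV′₁, dV′₂)` at the non-split `v`, witnessed
by `x`), so ★ (LM) `exists_intertwiner_lineWeilCM_of_eq_mul_norm` intertwines the two `ω¹`'s, and ★ (J1) `lineJacquet_transport` (pair side `refl`) moves the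
intertwiner. [cite: GelbartRogawski1991, §3.2 (3.2.1) p. 457; §5.2 p. 467] [cite: MoeglinVignerasWaldspurger1987, Chap. 2 II Remarque (3)] -/
theorem lineJacquet_lineChange {n' : ℕ} (e₁ : Fin 3 × Fin 1 ≃ Fin n') (dV' : Fin 3 → L)
    (hdV' : ∀ i, IsCMField.complexConj L (dV' i) = dV' i) (hdV'0 : ∀ i, dV' i ≠ 0) {n₀ : ℕ} (e₀ : Fin 1 × Fin 1 ≃ Fin n₀)
    (μ : Literature.NumberTheory.Automorphic.IdeleClassGroup L →ₜ* Circle) (hμ : IsConjugateSymplectic L μ)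
    (v : HeightOneSpectrum (𝓞 ↥(maximalRealSubfield L))) (hv : ∀ w : PlacesOver L v, IsCMField.complexConj L • w.1 = w.1)
    (ε : (↥(maximalRealSubfield L))ˣ)
    (T : GL (Fin 3) (UnitaryGroup.LocalRing L v)) {a : UnitaryGroup.LocalRing L v} (ha : IsUnit a)
    (h : formCongr (conjLocal L (IsCMField.complexConj L) v) T ((Matrix.diagonal dV').map (algebraMap L (UnitaryGroup.LocalRing L v))) =
      a • (Matrix.of fun i j : Fin 3 => if i.val + j.val + 1 = 3 then (1 : L) else 0).map (algebraMap L (UnitaryGroup.LocalRing L v)))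
    (x : Fin 2 → UnitaryGroup.LocalRing L v) (hx0 : x ≠ 0)
    (hxx : hermForm (conjLocal L (IsCMField.complexConj L) v)
      ((Matrix.diagonal fun k : Fin 2 => dV' k.succ).map (algebraMap L (UnitaryGroup.LocalRing L v))) x x = 0)
    (hN : ∃ Tr : ((cmBorelTriple L 3 v).restrict
      (((chiLocalSplittingsCM L e₁ dV' hdV' hdV'0 (toHeckeCharacter L μ) ((isOscillatorChar_toHeckeCharacter_iff μ).mpr hμ) ε).omegaLoc v).comp
        ((localLineInl L (IsCMField.complexConj L) 3 e₁ (Matrix.diagonal dV') (JW (↥(maximalRealSubfield L)) L ε) v).comp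
          ((localPiEquiv L (IsCMField.complexConj L) 3 (Matrix.diagonal dV') v).symm.toMonoidHom.comp
            (cmDatumLocalCongr L v T ha h).toMonoidHom)))).Coinvariants ≃ₗ[ℂ]
      SchwartzBruhat (Fin 1 → v.adicCompletion ↥(maximalRealSubfield L)),
      ∀ (u : localPi L (IsCMField.complexConj L) 1 (JW (↥(maximalRealSubfield L)) L ε) v) (t : ↥(cmBorelTriple L 3 v).M),
        glDiagonal 3 (LocalRing L v) ![1, ((localDet (IsCMField.complexConj L) v
          (isUnit_iff_ne_zero.mpr (by rw [Matrix.det_fin_one]; exact JW_apply_ne_zero (↥(maximalRealSubfield L)) L ε))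
          (localPiEquiv L (IsCMField.complexConj L) 1 (JW (↥(maximalRealSubfield L)) L ε) v u) :
            ↥(normOneUnits (conjLocal L (IsCMField.complexConj L) v))) : (LocalRing L v)ˣ), 1] =
          ((t : ↥(unitaryGroupOfForm (conjLocal L (IsCMField.complexConj L) v) (cmLocalForm L 3 v))) : GL (Fin 3) (LocalRing L v)) →
        ∀ x, Tr (Representation.jacquetModule
          (((chiLocalSplittingsCM L e₁ dV' hdV' hdV'0 (toHeckeCharacter L μ) ((isOscillatorChar_toHeckeCharacter_iff μ).mpr hμ) ε).omegaLoc v).comp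
            ((localLineInl L (IsCMField.complexConj L) 3 e₁ (Matrix.diagonal dV') (JW (↥(maximalRealSubfield L)) L ε) v).comp
              ((localPiEquiv L (IsCMField.complexConj L) 3 (Matrix.diagonal dV') v).symm.toMonoidHom.comp
                (cmDatumLocalCongr L v T ha h).toMonoidHom)))
          (cmBorelTriple L 3 v) t x) =
          lineWeilCM L (Equiv.prodUnique (Fin 1) (Fin 1)) (fun _ => dV' 0) (fun _ => hdV' 0) (fun _ => hdV'0 0) μ hμ ε v u (Tr x)) :
    ∃ Tr : ((cmBorelTriple L 3 v).restrict
      (((chiLocalSplittingsCM L e₁ dV' hdV' hdV'0 (toHeckeCharacter L μ) ((isOscillatorChar_toHeckeCharacter_iff μ).mpr hμ) ε).omegaLoc v).comp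
        ((localLineInl L (IsCMField.complexConj L) 3 e₁ (Matrix.diagonal dV') (JW (↥(maximalRealSubfield L)) L ε) v).comp
          ((localPiEquiv L (IsCMField.complexConj L) 3 (Matrix.diagonal dV') v).symm.toMonoidHom.comp
            (cmDatumLocalCongr L v T ha h).toMonoidHom)))).Coinvariants ≃ₗ[ℂ]
      SchwartzBruhat (Fin n₀ → v.adicCompletion ↥(maximalRealSubfield L)),
      ∀ (u : localPi L (IsCMField.complexConj L) 1 (JW (↥(maximalRealSubfield L)) L ε) v) (t : ↥(cmBorelTriple L 3 v).M),
        glDiagonal 3 (LocalRing L v) ![1, ((localDet (IsCMField.complexConj L) v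
          (isUnit_iff_ne_zero.mpr (by rw [Matrix.det_fin_one]; exact JW_apply_ne_zero (↥(maximalRealSubfield L)) L ε))
          (localPiEquiv L (IsCMField.complexConj L) 1 (JW (↥(maximalRealSubfield L)) L ε) v u) :
            ↥(normOneUnits (conjLocal L (IsCMField.complexConj L) v))) : (LocalRing L v)ˣ), 1] =
          ((t : ↥(unitaryGroupOfForm (conjLocal L (IsCMField.complexConj L) v) (cmLocalForm L 3 v))) : GL (Fin 3) (LocalRing L v)) →
        ∀ x, Tr (Representation.jacquetModule
          (((chiLocalSplittingsCM L e₁ dV' hdV' hdV'0 (toHeckeCharacter L μ) ((isOscillatorChar_toHeckeCharacter_iff μ).mpr hμ) ε).omegaLoc v).comp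
            ((localLineInl L (IsCMField.complexConj L) 3 e₁ (Matrix.diagonal dV') (JW (↥(maximalRealSubfield L)) L ε) v).comp
              ((localPiEquiv L (IsCMField.complexConj L) 3 (Matrix.diagonal dV') v).symm.toMonoidHom.comp
                (cmDatumLocalCongr L v T ha h).toMonoidHom)))
          (cmBorelTriple L 3 v) t x) =
          lineWeilCM L e₀ (kernelLineCM dV') (complexConj_kernelLineCM dV' hdV') (kernelLineCM_ne_zero dV' hdV'0) μ hμ ε v u (Tr x) := by
  -- the kernel line is the frame line times a local norm `N(y)` (★ (KL)), so the two `ω¹`'s are intertwined (★ (LM))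
  obtain ⟨y, hty⟩ := F0P2oKernelLineNormUnit.exists_unit_norm_kernelLineCM L v hv dV' hdV' hdV'0 x hx0 hxx
  obtain ⟨TrL, hTrL⟩ := F0P2oLineWeilCMLineMatching.exists_intertwiner_lineWeilCM_of_eq_mul_norm L e₀ (Equiv.prodUnique (Fin 1) (Fin 1))
    (kernelLineCM dV') (fun _ => dV' 0) (complexConj_kernelLineCM dV' hdV') (kernelLineCM_ne_zero dV' hdV'0) (fun _ => hdV' 0) (fun _ => hdV'0 0)
    μ hμ ε v y hty
  -- ★ (J1) with the pair side untouched and the line side `TrL⁻¹`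
  exact lineJacquet_transport _ _ (LinearEquiv.refl ℂ _) (fun _ _ => rfl) (cmBorelTriple L 3 v)
    (lineWeilCM L (Equiv.prodUnique (Fin 1) (Fin 1)) (fun _ => dV' 0) (fun _ => hdV' 0) (fun _ => hdV'0 0) μ hμ ε v)
    (lineWeilCM L e₀ (kernelLineCM dV') (complexConj_kernelLineCM dV' hdV') (kernelLineCM_ne_zero dV' hdV'0) μ hμ ε v)
    TrL.symm (fun u m => TrL.injective (by rw [LinearEquiv.apply_symm_apply, hTrL, LinearEquiv.apply_symm_apply])) _ hN

end LineChange

/-! ## §2 The junction at a block-diagonal frame: partner → (BF) → (C5) → (C5c′) → (J3) → (J2) → (J4) -/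

section Junction

variable (L : Type) [Field L] [NumberField L] [IsCMField L]

set_option synthInstance.maxHeartbeats 400000 in
set_option maxHeartbeats 32000000 in
/-- **THE JUNCTION AT AN ABSTRACT BLOCK-DIAGONAL FRAME.**  Letter datum `(e₁, dV, e₀, μ, v` non-split, `ε, T, a, h)`; a rational frame `P ∈ GL₃(L⁺)` with
`Pᵀ·diag(dV)·P = diag(dV′)` and an isotropic vector `x` of the plane `diag(dV′₁, dV′₂)` at `v`.  Then (N′) holds at `(e₁, dV, T)` (F0P2-p06 (g4)'s `hTr` ∃-shape of
★ p837961): hyperbolic partner ★ `exists_hyperbolic_partner_of_nonsplit` → ★ (BF) p837182 `exists_blockAdaptedCongr` (`T₀`, `T₀ 0 0 = T₀ 0 2 = 0`, torus law (i)) →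
★ (C5) `exists_lineJacquet_intertwiner_blockFrame` → §1 (C5c′) → ★ (J3) `lineJacquet_congruenceChange_of_formCongr` (`T₀ ↝ T′ := framePloc(P)⁻¹·T`, `h′` = ★
`formCongr_framePlocInv_mul`) → ★ (J2) `lineJacquet_frameTransport_ofRecord` (`(dV′, T′) ↝ (dV, T)`, `hT′` by `mul_inv_cancel_left`) → ★ (J4) `lineJacquet_reindex_std`.
[cite: GelbartRogawski1991, §3.2 (3.2.1)–(3.2.3) p. 457] [cite: Kudla1986, Thm. 2.8] [cite: MoeglinVignerasWaldspurger1987, Chap. 2 II Remarque (3)] -/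
theorem lineJacquet_of_blockDiagonalFrame
    {n' : ℕ} (e₁ : Fin 3 × Fin 1 ≃ Fin n') (dV : Fin 3 → L) (hdV : ∀ i, IsCMField.complexConj L (dV i) = dV i) (hdV0 : ∀ i, dV i ≠ 0)
    {n₀ : ℕ} (e₀ : Fin 1 × Fin 1 ≃ Fin n₀)
    (μ : Literature.NumberTheory.Automorphic.IdeleClassGroup L →ₜ* Circle) (hμ : IsConjugateSymplectic L μ)
    (v : HeightOneSpectrum (𝓞 ↥(maximalRealSubfield L))) (hv : ∀ w : PlacesOver L v, IsCMField.complexConj L • w.1 = w.1)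
    (ε : (↥(maximalRealSubfield L))ˣ)
    (T : GL (Fin 3) (UnitaryGroup.LocalRing L v)) {a : UnitaryGroup.LocalRing L v} (ha : IsUnit a)
    (h : formCongr (conjLocal L (IsCMField.complexConj L) v) T ((Matrix.diagonal dV).map (algebraMap L (UnitaryGroup.LocalRing L v))) =
      a • (Matrix.of fun i j : Fin 3 => if i.val + j.val + 1 = 3 then (1 : L) else 0).map (algebraMap L (UnitaryGroup.LocalRing L v)))
    (dV' : Fin 3 → L) (hdV' : ∀ i, IsCMField.complexConj L (dV' i) = dV' i) (hdV'0 : ∀ i, dV' i ≠ 0)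
    (P : GL (Fin 3) ↥(maximalRealSubfield L))
    (hP : (P : Matrix (Fin 3) (Fin 3) ↥(maximalRealSubfield L))ᵀ * realDiagonal L dV hdV * (P : Matrix (Fin 3) (Fin 3) ↥(maximalRealSubfield L)) =
      realDiagonal L dV' hdV')
    (x : Fin 2 → UnitaryGroup.LocalRing L v) (hx0 : x ≠ 0)
    (hxx : hermForm (conjLocal L (IsCMField.complexConj L) v)
      ((Matrix.diagonal fun k : Fin 2 => dV' k.succ).map (algebraMap L (UnitaryGroup.LocalRing L v))) x x = 0) :
    ∃ Tr : ((cmBorelTriple L 3 v).restrict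
            (((chiLocalSplittingsCM L e₁ dV hdV hdV0 (toHeckeCharacter L μ) ((isOscillatorChar_toHeckeCharacter_iff μ).mpr hμ) ε).omegaLoc v).comp
              ((localLineInl L (IsCMField.complexConj L) 3 e₁ (Matrix.diagonal dV) (JW (↥(maximalRealSubfield L)) L ε) v).comp
                ((localPiEquiv L (IsCMField.complexConj L) 3 (Matrix.diagonal dV) v).symm.toMonoidHom.comp
                  (cmDatumLocalCongr L v T ha h).toMonoidHom)))).Coinvariants ≃ₗ[ℂ]
            SchwartzBruhat (Fin n₀ → v.adicCompletion ↥(maximalRealSubfield L)),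
          ∀ (u : localPi L (IsCMField.complexConj L) 1 (JW (↥(maximalRealSubfield L)) L ε) v) (t : ↥(cmBorelTriple L 3 v).M),
            glDiagonal 3 (LocalRing L v) ![1, ((localDet (IsCMField.complexConj L) v
              (isUnit_iff_ne_zero.mpr (by rw [Matrix.det_fin_one]; exact JW_apply_ne_zero (↥(maximalRealSubfield L)) L ε))
              (localPiEquiv L (IsCMField.complexConj L) 1 (JW (↥(maximalRealSubfield L)) L ε) v u) :
                ↥(normOneUnits (conjLocal L (IsCMField.complexConj L) v))) : (LocalRing L v)ˣ), 1] =
              ((t : ↥(unitaryGroupOfForm (conjLocal L (IsCMField.complexConj L) v) (cmLocalForm L 3 v))) : GL (Fin 3) (LocalRing L v)) →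
            ∀ x, Tr (Representation.jacquetModule
              (((chiLocalSplittingsCM L e₁ dV hdV hdV0 (toHeckeCharacter L μ) ((isOscillatorChar_toHeckeCharacter_iff μ).mpr hμ) ε).omegaLoc v).comp
                ((localLineInl L (IsCMField.complexConj L) 3 e₁ (Matrix.diagonal dV) (JW (↥(maximalRealSubfield L)) L ε) v).comp
                  ((localPiEquiv L (IsCMField.complexConj L) 3 (Matrix.diagonal dV) v).symm.toMonoidHom.comp
                    (cmDatumLocalCongr L v T ha h).toMonoidHom)))
              (cmBorelTriple L 3 v) t x) =
              lineWeilCM L e₀ (kernelLineCM dV) (complexConj_kernelLineCM dV hdV) (kernelLineCM_ne_zero dV hdV0) μ hμ ε v u (Tr x) := by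
  -- hyperbolic partner of `x` in the plane, scaled to `⟨x, xs⟩ = dV′ 0`
  obtain ⟨xs, hss, hxs⟩ := F0P2oBlockAdaptedCongruence.exists_hyperbolic_partner_of_nonsplit L v hv (fun k : Fin 2 => dV' k.succ)
    (fun k => hdV' k.succ) (fun k => hdV'0 k.succ) (dV' 0) x hx0 hxx
  -- (BF) the block-adapted congruence `T₀` of `diag(dV′)`
  obtain ⟨X, T₀, hX, h₀, -, hT₀val, hinl, -⟩ := F0P2oBlockAdaptedCongruence.exists_blockAdaptedCongr L v dV' hdV' hdV'0 x xs hxx hss hxs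
  have h00 : (T₀ : Matrix (Fin 3) (Fin 3) (UnitaryGroup.LocalRing L v)) 0 0 = 0 := by rw [hT₀val]; rfl
  have h02 : (T₀ : Matrix (Fin 3) (Fin 3) (UnitaryGroup.LocalRing L v)) 0 2 = 0 := by rw [hT₀val]; rfl
  -- (C5) at `(e_std, dV′, T₀)` with the frame line, then (C5c′) to the kernel line at `e₀`
  have hN₅ := F0P2oLineJacquetAtBlockFrame.exists_lineJacquet_intertwiner_blockFrame L dV' hdV' hdV'0 μ hμ v hv ε T₀ h₀ h00 h02 hinl
  have hN₅' := lineJacquet_lineChange L (Equiv.prodUnique (Fin 3) (Fin 1)) dV' hdV' hdV'0 e₀ μ hμ v hv ε T₀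
    ((hdV'0 0).isUnit.map (algebraMap L (UnitaryGroup.LocalRing L v))) h₀ x hx0 hxx hN₅
  -- (J3) `T₀ ↝ T′ := framePloc(P)⁻¹ · T` on `diag(dV′)`
  have h' := F0P2oLineWeilDictionaryFrameTransport.formCongr_framePlocInv_mul L v dV dV' hdV hdV' P hP T a h
  have hN₃ := lineJacquet_congruenceChange_of_formCongr L v dV' hdV' T₀ ((hdV'0 0).isUnit.map (algebraMap L (UnitaryGroup.LocalRing L v))) h₀
    ((FrameTransport.framePloc (↥(maximalRealSubfield L)) L v 3 P)⁻¹ * T) ha h' hdV'0 (Equiv.prodUnique (Fin 3) (Fin 1)) ε e₀ μ hμ hN₅'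
  -- (J2) `(dV′, T′) ↝ (dV, T)` at `e_std`
  have hN₂ := lineJacquet_frameTransport_ofRecord L v dV dV' hdV hdV' P hP (Equiv.prodUnique (Fin 3) (Fin 1))
    hdV0 hdV'0 ε e₀ μ hμ T ha h ((FrameTransport.framePloc (↥(maximalRealSubfield L)) L v 3 P)⁻¹ * T) (mul_inv_cancel_left _ _) ha h' hN₃
  -- (J4) `e_std ↝ e₁`
  exact F0P2oLineJacquetReindex.lineJacquet_reindex_std L v dV hdV hdV0 ε e₁ e₀ μ hμ T ha h hN₂

end Junction

/-! ## §3 (N′) FOR EVERY LETTER DATUM, and N3 AS A THEOREM -/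

set_option synthInstance.maxHeartbeats 400000 in
set_option maxHeartbeats 32000000 in
/-- **(JA) THE LINE-JACQUET INTERTWINER (N′) HOLDS FOR EVERY DATUM OF THE LETTER** — the `hL` binder of ★ p837961
`F0P2oN3OfLineJacquet.thetaType_nonsplit_jacquetModule_of_lineJacquet`, token for token, HYPOTHESIS-FREE: (F′) ★ `exists_rational_hyperbolic_realDiagonal_frame` (non-split ⇒
`E_v` a field, ★ `LocalRing.isField_of_smul_eq`) → (IB) ★ `exists_ne_zero_hermForm_self_eq_zero_of_isIsotropic` → §2.  Print: «`ω_ψ(diag(1, u, 1)) Φ(w) =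
ω_ψ^{s′}(u)(Φ(w))`» on `r_N(ω³) ≅ ℱ` for the `γ`-normalised oscillator representations `ω³, ω¹`. [cite: GelbartRogawski1991, §3.2 (3.2.1)–(3.2.3) p. 457; §5.2 p. 467 L8–11]
[cite: Kudla1986, Thm. 2.8] [cite: Jacobowitz1962, Thm. 3.1] -/
theorem lineJacquet_holds :
    ∀ (L : Type) [Field L] [NumberField L] [IsCMField L]
      {n' : ℕ} (e₁ : Fin 3 × Fin 1 ≃ Fin n') (dV : Fin 3 → L) (hdV : ∀ i, IsCMField.complexConj L (dV i) = dV i) (hdV0 : ∀ i, dV i ≠ 0)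
      {n₀ : ℕ} (e₀ : Fin 1 × Fin 1 ≃ Fin n₀)
      (μ : Literature.NumberTheory.Automorphic.IdeleClassGroup L →ₜ* Circle) (hμ : IsConjugateSymplectic L μ)
      (v : HeightOneSpectrum (𝓞 ↥(maximalRealSubfield L))),
        (∀ w : PlacesOver L v, IsCMField.complexConj L • w.1 = w.1) →
        ∀ (ε : (↥(maximalRealSubfield L))ˣ)
          (T : GL (Fin 3) (UnitaryGroup.LocalRing L v)) (a : UnitaryGroup.LocalRing L v) (ha : IsUnit a)
          (h : formCongr (conjLocal L (IsCMField.complexConj L) v) T ((Matrix.diagonal dV).map (algebraMap L (UnitaryGroup.LocalRing L v))) =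
            a • (Matrix.of fun i j : Fin 3 => if i.val + j.val + 1 = 3 then (1 : L) else 0).map (algebraMap L (UnitaryGroup.LocalRing L v))),
          ∃ Tr : ((cmBorelTriple L 3 v).restrict
                  (((chiLocalSplittingsCM L e₁ dV hdV hdV0 (toHeckeCharacter L μ) ((isOscillatorChar_toHeckeCharacter_iff μ).mpr hμ) ε).omegaLoc v).comp
                    ((localLineInl L (IsCMField.complexConj L) 3 e₁ (Matrix.diagonal dV) (JW (↥(maximalRealSubfield L)) L ε) v).comp
                      ((localPiEquiv L (IsCMField.complexConj L) 3 (Matrix.diagonal dV) v).symm.toMonoidHom.comp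
                        (cmDatumLocalCongr L v T ha h).toMonoidHom)))).Coinvariants ≃ₗ[ℂ]
                  SchwartzBruhat (Fin n₀ → v.adicCompletion ↥(maximalRealSubfield L)),
                ∀ (u : localPi L (IsCMField.complexConj L) 1 (JW (↥(maximalRealSubfield L)) L ε) v) (t : ↥(cmBorelTriple L 3 v).M),
                  glDiagonal 3 (LocalRing L v) ![1, ((localDet (IsCMField.complexConj L) v
                    (isUnit_iff_ne_zero.mpr (by rw [Matrix.det_fin_one]; exact JW_apply_ne_zero (↥(maximalRealSubfield L)) L ε))
                    (localPiEquiv L (IsCMField.complexConj L) 1 (JW (↥(maximalRealSubfield L)) L ε) v u) :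
                      ↥(normOneUnits (conjLocal L (IsCMField.complexConj L) v))) : (LocalRing L v)ˣ), 1] =
                    ((t : ↥(unitaryGroupOfForm (conjLocal L (IsCMField.complexConj L) v) (cmLocalForm L 3 v))) : GL (Fin 3) (LocalRing L v)) →
                  ∀ x, Tr (Representation.jacquetModule
                    (((chiLocalSplittingsCM L e₁ dV hdV hdV0 (toHeckeCharacter L μ) ((isOscillatorChar_toHeckeCharacter_iff μ).mpr hμ) ε).omegaLoc v).comp
                      ((localLineInl L (IsCMField.complexConj L) 3 e₁ (Matrix.diagonal dV) (JW (↥(maximalRealSubfield L)) L ε) v).comp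
                        ((localPiEquiv L (IsCMField.complexConj L) 3 (Matrix.diagonal dV) v).symm.toMonoidHom.comp
                          (cmDatumLocalCongr L v T ha h).toMonoidHom)))
                    (cmBorelTriple L 3 v) t x) =
                    lineWeilCM L e₀ (kernelLineCM dV) (complexConj_kernelLineCM dV hdV) (kernelLineCM_ne_zero dV hdV0) μ hμ ε v u (Tr x) := by
  intro L _ _ _ n' e₁ dV hdV hdV0 n₀ e₀ μ hμ v hv ε T a ha h
  -- (F′) a rational frame `P` with `Pᵀ·diag(dV)·P = diag(t, a′)` and `diag(a′)` isotropic at the non-split `v`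
  obtain ⟨w⟩ := (inferInstance : Nonempty (PlacesOver L v))
  have hE : IsField (UnitaryGroup.LocalRing L v) := LocalRing.isField_of_smul_eq (IsCMField.complexConj L) (IsCMField.complexConj_ne_one L) w (hv w)
  obtain ⟨P, t, a', ha', -, hP, hdV'0, hiso⟩ := RationalHyperbolicFrame.exists_rational_hyperbolic_realDiagonal_frame L v hE dV hdV hdV0
  -- (IB) an isotropic vector of the plane
  obtain ⟨x, hx0, hxx⟩ := F0P2oBlockFrameIsotropyBridge.exists_ne_zero_hermForm_self_eq_zero_of_isIsotropic L v a' hiso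
  exact lineJacquet_of_blockDiagonalFrame L e₁ dV hdV hdV0 e₀ μ hμ v hv ε T ha h _ _ hdV'0 P hP x hx0 (by simpa only [Fin.cons_succ] using hxx)

set_option synthInstance.maxHeartbeats 400000 in
set_option maxHeartbeats 8000000 in
/-- **N3 — [GelbartRogawski1991 §3.2 (3.2.1)–(3.2.3) p. 457; Kudla1986 Thm. 2.8] THE JACQUET MODULE OF THE LOCAL THETA TYPE AT A NON-SPLIT PLACE — IS A THEOREM OF THE TREE**:
★ `GelbartRogawski1991.thetaType_nonsplit_jacquetModule` (print letter #96, the K1 sub-line's `stub_N3_letter`), by ★ p837961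
`F0P2oN3OfLineJacquet.thetaType_nonsplit_jacquetModule_of_lineJacquet` at `lineJacquet_holds` (clause (a) «`r_N(X_v) ≃ ℱ_v[ψθ]`» ⟸ (N′); clause (b) the torus character
`χθ = μ_v‖·‖^{1/2} ⊗ ψθ` by ★ p836093 ∕ p835944 ∕ p835430).  Desk fold: `stub_N3_letter := …F0P2oLineJacquetHolds.thetaType_nonsplit_jacquetModule_holds`.
[cite: GelbartRogawski1991, §3.2 (3.2.1)–(3.2.3) p. 457; §3.2 Remark (1) pp. 457–458; §5.2 p. 467 L8–11] [cite: Kudla1986, Thm. 2.8] [cite: Rogawski1990, §12.2 (2) p. 174] -/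
theorem thetaType_nonsplit_jacquetModule_holds : Literature.NumberTheory.GelbartRogawski1991.thetaType_nonsplit_jacquetModule :=
  F0P2oN3OfLineJacquet.thetaType_nonsplit_jacquetModule_of_lineJacquet lineJacquet_holds

end Summit.HodgeConjecture.HodgeConjecture.Cruxes.H413.F0P2oLineJacquetHolds

end
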